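import Mathlib.Analysis.Calculus.BumpFunction.FiniteDimension
import Mathlib.Analysis.Calculus.ContDiff.Deriv
import Mathlib.Analysis.Distribution.AEEqOfIntegralContDiff
import Mathlib.MeasureTheory.Integral.IntervalIntegral.FundThmCalculus
import Mathlib.MeasureTheory.Integral.Prod
import HarnessLib

/-!
# The du Bois-Reymond lemma with initial datum, almost-everywhere form, and Fubini on a triangle

Analysis/FunctionSpaces support file (serves the discharge of the DiPerna–Lions uniqueness fact
`Literature.Analysis.FluidPDE.Torus.IsWeakScalarTransportOn.unique_of_lipschitz`, `FluidPDE/PassiveScalar`: it is the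
one-dimensional (time) core of the passage from the space–time weak formulation of a transport
equation, tested with `η(t)k(x - ·)`, to the time-sliced identity
`θ_ε(t, x) = ∫₀ᵗ ∂ₜθ_ε(s, x) ds` for almost every `t`, and of the energy identity
`‖θ_ε(t)‖² = 2∫₀ᵗ ⟨∂ₜθ_ε, θ_ε⟩`; DiPerna–Lions 1989, proof of Thm. II.2).

* `Literature.Analysis.FunctionSpaces.setIntegral_mul_setIntegral_add_symm` — **Fubini on a triangle**: for `f, g` integrable on
  `(a, b]`, `∫ f(s) (∫_{(a,s]} g) ds + ∫ g(r) (∫_{(a,r]} f) dr = (∫ f)(∫ g)` (all over `(a, b]`);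
  the case `f = g` is the "chain rule" `(∫_{(a,b]} g)² = 2 ∫ g(s) ∫_{(a,s]} g ds` for the
  primitive of an `L¹` function (`Literature.Analysis.FunctionSpaces.sq_setIntegral_eq_two_mul`).
* `Literature.Analysis.FunctionSpaces.setIntegral_deriv_mul_primitive` — integration by parts against a primitive:
  `∫_{(0,T)} η'(s) (∫_{(0,s]} F) ds = -∫_{(0,T)} η F` for `F ∈ L¹(0,T)` and a `C¹` `η` with
  compact support in `(-∞, T)`.
* `Literature.Analysis.FunctionSpaces.mul_eq_add_setIntegral_of_eq_add_setIntegral` — the **product formula for two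
  primitives** `F = α + ∫φ`, `G = β + ∫γ` of `L¹` functions on `(0,T]`: `FG(t) = αβ + ∫_{(0,t]}(φG + Fγ)`
  (integration by parts for absolutely continuous functions in integral form; from the triangle
  Fubini identity), appended for the Galerkin-level cross identities of `FluidPDE/`.
* `Literature.Analysis.FunctionSpaces.ae_eq_add_setIntegral_of_forall_test` — **du Bois-Reymond lemma with initial datum,
  a.e. form.** Let `U, F` be integrable on `(0, T)`, `c ∈ ℝ`, and suppose that for every smooth
  compactly supported `η : ℝ → ℝ` with `tsupport η ⊆ (-∞, T)`,
  `∫_{(0,T)} (η' U + η F) + η(0) c = 0`. Then `U(t) = c + ∫_{(0,t]} F` for a.e. `t ∈ (0, T)`.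
  (The sibling file `DuBoisReymond` proves the same conclusion for *every* `t` when `U` is
  continuous; here no continuity is assumed.)

Proof of the last: `V(t) = c + ∫_{(0,t]} F` satisfies the same identity
(`setIntegral_deriv_mul_primitive` and `∫ η' = -η(0)`), so `W = U - V` satisfies
`∫_{(0,T)} η' W = 0` for all such `η`; every smooth `φ` compactly supported in `(0, T)` is such a
derivative on `(0, T)` (`η = B · (∫₀ φ - ∫ φ)` with a bump `B ≡ 1` on `[-1, T + 1]`), so
`∫ φ W = 0`, and the fundamental lemma of the calculus of variations (Mathlib's
`IsOpen.ae_eq_zero_of_integral_contDiff_smul_eq_zero`) gives `W = 0` a.e. on `(0, T)`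
(Brezis 2011, Lemma 8.1 and the proof of Thm. 8.2; Galdi 2000, Lemma 2.1).

## Mathlib search

Mathlib (this pin) has the fundamental lemma of the calculus of variations
(`IsOpen.ae_eq_zero_of_integral_contDiff_smul_eq_zero`) but no du Bois-Reymond lemma and no
absolutely continuous representative / chain rule for primitives of `L¹` functions (searched
`du Bois`, `ae_eq_const_of`, `integral_deriv`, `sq_integral` in `MeasureTheory/`, `Analysis/`).

## References

* H. Brezis, *Functional Analysis, Sobolev Spaces and PDE* (Springer 2011), Lemma 8.1, Thm. 8.2.
* G. P. Galdi, *An introduction to the Navier–Stokes initial-boundary value problem*, in: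
  Fundamental Directions in Mathematical Fluid Mechanics, Birkhäuser 2000, Lemma 2.1.
* R. J. DiPerna, P.-L. Lions, *Ordinary differential equations, transport theory and Sobolev
  spaces*, Invent. Math. 98 (1989), 511–547, proof of Thm. II.2.
-/

noncomputable section

open MeasureTheory TopologicalSpace Set Function Filter Topology intervalIntegral
open scoped ContDiff

namespace Literature.Analysis.FunctionSpaces

/-! ### Fubini on a triangle -/

/-- **Fubini on a triangle.** For `f, g` integrable on `(a, b]`,
`∫_{(a,b]} f(s) (∫_{(a,s]} g) ds + ∫_{(a,b]} g(r) (∫_{(a,r]} f) dr = (∫_{(a,b]} f) (∫_{(a,b]} g)`: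
split the square `(a,b]²` into `{r ≤ s}` and `{s < r}` and integrate the product `f(s) g(r)`
over each piece in the appropriate order (the diagonal is Lebesgue-null, so `(a, r)` may be
replaced by `(a, r]`). [folklore] -/
theorem setIntegral_mul_setIntegral_add_symm {a b : ℝ} {f g : ℝ → ℝ}
    (hf : IntegrableOn f (Ioc a b)) (hg : IntegrableOn g (Ioc a b)) :
    (∫ s in Ioc a b, f s * ∫ r in Ioc a s, g r) + (∫ r in Ioc a b, g r * ∫ s in Ioc a r, f s) =
      (∫ s in Ioc a b, f s) * ∫ r in Ioc a b, g r := by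
  set μ : Measure ℝ := volume.restrict (Ioc a b) with hμ
  have hprod : Integrable (fun z : ℝ × ℝ => f z.1 * g z.2) (μ.prod μ) := hf.mul_prod hg
  have hS : MeasurableSet {z : ℝ × ℝ | z.2 ≤ z.1} := measurableSet_le measurable_snd measurable_fst
  rw [← integral_prod_mul (μ := μ) (ν := μ) f g,
    ← indicator_self_add_compl {z : ℝ × ℝ | z.2 ≤ z.1} (fun z : ℝ × ℝ => f z.1 * g z.2),
    integral_add' (hprod.indicator hS) (hprod.indicator hS.compl)]
  congr 1
  · -- the piece `{r ≤ s}`, integrated first in `r`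
    rw [integral_prod _ (hprod.indicator hS)]
    refine integral_congr_ae ?_
    filter_upwards [ae_restrict_mem measurableSet_Ioc] with s hs
    have h1 : (fun r => {z : ℝ × ℝ | z.2 ≤ z.1}.indicator (fun z : ℝ × ℝ => f z.1 * g z.2) (s, r)) =
        fun r => f s * (Iic s).indicator g r := by
      funext r
      by_cases hr : r ≤ s
      · rw [indicator_of_mem (show (s, r) ∈ {z : ℝ × ℝ | z.2 ≤ z.1} from hr),
          indicator_of_mem (show r ∈ Iic s from hr)]
      · rw [indicator_of_notMem (show (s, r) ∉ {z : ℝ × ℝ | z.2 ≤ z.1} from hr),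
          indicator_of_notMem (show r ∉ Iic s from hr), mul_zero]
    have hset : Ioc a b ∩ Iic s = Ioc a s := by
      ext r
      simp only [mem_inter_iff, mem_Ioc, mem_Iic]
      constructor
      · rintro ⟨⟨h1, -⟩, h3⟩
        exact ⟨h1, h3⟩
      · rintro ⟨h1, h2⟩
        exact ⟨⟨h1, h2.trans hs.2⟩, h2⟩
    rw [h1, MeasureTheory.integral_const_mul, hμ, setIntegral_indicator measurableSet_Iic, hset]
  · -- the piece `{s < r}`, integrated first in `s`
    rw [integral_prod_symm _ (hprod.indicator hS.compl)]
    refine integral_congr_ae ?_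
    filter_upwards [ae_restrict_mem measurableSet_Ioc] with r hr
    have h1 : (fun s => {z : ℝ × ℝ | z.2 ≤ z.1}ᶜ.indicator (fun z : ℝ × ℝ => f z.1 * g z.2) (s, r)) =
        fun s => g r * (Iio r).indicator f s := by
      funext s
      by_cases hs : s < r
      · rw [indicator_of_mem (show (s, r) ∈ {z : ℝ × ℝ | z.2 ≤ z.1}ᶜ from not_le.2 hs),
          indicator_of_mem (show s ∈ Iio r from hs), mul_comm]
      · rw [indicator_of_notMem (show (s, r) ∉ {z : ℝ × ℝ | z.2 ≤ z.1}ᶜ from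
            fun h => h (not_lt.1 hs)),
          indicator_of_notMem (show s ∉ Iio r from hs), mul_zero]
    have hset : Ioc a b ∩ Iio r = Ioo a r := by
      ext s
      simp only [mem_inter_iff, mem_Ioc, mem_Iio, mem_Ioo]
      constructor
      · rintro ⟨⟨h1, -⟩, h3⟩
        exact ⟨h1, h3⟩
      · rintro ⟨h1, h2⟩
        exact ⟨⟨h1, h2.le.trans hr.2⟩, h2⟩
    rw [h1, MeasureTheory.integral_const_mul, hμ, setIntegral_indicator measurableSet_Iio, hset,
      integral_Ioc_eq_integral_Ioo]

/-- **Chain rule for the square of a primitive of an `L¹` function**: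
`(∫_{(a,b]} g)² = 2 ∫_{(a,b]} g(s) (∫_{(a,s]} g) ds` for `g` integrable on `(a, b]` — the case
`f = g` of `setIntegral_mul_setIntegral_add_symm`; it replaces the pointwise identity
`(Γ²)' = 2 Γ Γ'` for the absolutely continuous `Γ(s) = ∫_{(a,s]} g`. [folklore] -/
theorem sq_setIntegral_eq_two_mul {a b : ℝ} {g : ℝ → ℝ} (hg : IntegrableOn g (Ioc a b)) :
    (∫ s in Ioc a b, g s) ^ 2 = 2 * ∫ s in Ioc a b, g s * ∫ r in Ioc a s, g r := by
  rw [sq, ← setIntegral_mul_setIntegral_add_symm hg hg, two_mul]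

/-! ### Integration by parts against a primitive -/

/-- A compactly supported function with `tsupport ⊆ (-∞, T)` vanishes on `[T', ∞)` for some
`T' < T`. [folklore] -/
theorem exists_lt_forall_eq_zero_of_tsupport_subset_Iio {E : Type*} [Zero E] {η : ℝ → E} {T : ℝ}
    (hη : HasCompactSupport η) (hT : tsupport η ⊆ Iio T) :
    ∃ T' < T, ∀ t, T' ≤ t → η t = 0 := by
  by_cases hne : (tsupport η).Nonempty
  · have hmem : sSup (tsupport η) ∈ tsupport η := hη.isCompact.sSup_mem hne
    have hlt : sSup (tsupport η) < T := hT hmem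
    refine ⟨(sSup (tsupport η) + T) / 2, by linarith, fun t ht => ?_⟩
    refine image_eq_zero_of_notMem_tsupport fun h => ?_
    have h' : t ≤ sSup (tsupport η) := le_csSup hη.isCompact.bddAbove h
    linarith
  · refine ⟨T - 1, by linarith, fun t _ => ?_⟩
    exact image_eq_zero_of_notMem_tsupport fun h => hne ⟨t, h⟩

/-- A continuous compactly supported real function is bounded: `∃ C, ∀ x, |η x| ≤ C`. [folklore] -/
theorem exists_forall_abs_le_of_hasCompactSupport {η : ℝ → ℝ} (hc : Continuous η)
    (hη : HasCompactSupport η) : ∃ C, ∀ x, |η x| ≤ C := by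
  obtain ⟨C, hC⟩ := hc.bounded_above_of_compact_support hη
  exact ⟨C, fun x => by simpa [Real.norm_eq_abs] using hC x⟩

/-- A bounded continuous factor times an integrable function is integrable on a set. [folklore] -/
theorem integrableOn_continuous_mul_of_hasCompactSupport {η F : ℝ → ℝ} {s : Set ℝ}
    (hF : IntegrableOn F s) (hc : Continuous η) (hη : HasCompactSupport η) :
    IntegrableOn (fun x => η x * F x) s := by
  obtain ⟨C, hC⟩ := exists_forall_abs_le_of_hasCompactSupport hc hη
  exact Integrable.bdd_mul hF hc.aestronglyMeasurable
    (Eventually.of_forall fun x => by simpa [Real.norm_eq_abs] using hC x)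

/-- For a `C¹` compactly supported `η` with `tsupport η ⊆ (-∞, T)` and `r ≤ T`:
`∫_{(r,T]} η' = -η(r)` (fundamental theorem of calculus, `η(T) = 0`). [folklore] -/
theorem setIntegral_Ioc_deriv_eq_neg {η : ℝ → ℝ} {T r : ℝ} (hη : ContDiff ℝ 1 η)
    (hsupp : HasCompactSupport η) (hT : tsupport η ⊆ Iio T) (hr : r ≤ T) :
    ∫ s in Ioc r T, deriv η s = -η r := by
  obtain ⟨T', hT'T, hT'⟩ := exists_lt_forall_eq_zero_of_tsupport_subset_Iio hsupp hT
  rw [← intervalIntegral.integral_of_le hr,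
    intervalIntegral.integral_deriv_eq_sub (fun x _ => (hη.differentiable one_ne_zero) x)
      ((hη.continuous_deriv le_rfl).intervalIntegrable _ _), hT' T hT'T.le, zero_sub]

/-- **Integration by parts against a primitive.** For `F` integrable on `(0, T)` and a `C¹`
compactly supported `η` with `tsupport η ⊆ (-∞, T)`:
`∫_{(0,T)} η'(s) (∫_{(0,s]} F) ds = -∫_{(0,T)} η(s) F(s) ds`. Proof: Fubini on the triangle
(`setIntegral_mul_setIntegral_add_symm` with `f = η'`, `g = F`) and `∫_{(r,T]} η' = -η(r)`.
[folklore] -/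
theorem setIntegral_deriv_mul_primitive {T : ℝ} {F η : ℝ → ℝ} (hF : IntegrableOn F (Ioo 0 T))
    (hη : ContDiff ℝ 1 η) (hsupp : HasCompactSupport η) (hT : tsupport η ⊆ Iio T) :
    ∫ s in Ioo 0 T, deriv η s * ∫ r in Ioc 0 s, F r = -∫ s in Ioo 0 T, η s * F s := by
  rcases le_or_gt T 0 with hT0 | hT0
  · simp [Ioo_eq_empty_of_le hT0]
  have hF' : IntegrableOn F (Ioc 0 T) :=
    (integrableOn_congr_set_ae (Ioo_ae_eq_Ioc (μ := volume) (a := 0) (b := T))).1 hF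
  have hdc : Continuous (deriv η) := hη.continuous_deriv le_rfl
  have hd : IntegrableOn (deriv η) (Ioc 0 T) :=
    hdc.integrableOn_Icc.mono_set Ioc_subset_Icc_self
  have key := setIntegral_mul_setIntegral_add_symm hd hF'
  have h0 : ∫ s in Ioc 0 T, deriv η s = -η 0 := setIntegral_Ioc_deriv_eq_neg hη hsupp hT hT0.le
  have h1 : ∀ r ∈ Ioc 0 T, ∫ s in Ioc 0 r, deriv η s = η r - η 0 := fun r hr => by
    rw [← intervalIntegral.integral_of_le hr.1.le,
      intervalIntegral.integral_deriv_eq_sub (fun x _ => (hη.differentiable one_ne_zero) x)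
        (hdc.intervalIntegrable _ _)]
  have hηF : IntegrableOn (fun r => η r * F r) (Ioc 0 T) :=
    integrableOn_continuous_mul_of_hasCompactSupport hF' hη.continuous hsupp
  have h2 : ∫ r in Ioc 0 T, F r * ∫ s in Ioc 0 r, deriv η s =
      (∫ r in Ioc 0 T, η r * F r) - η 0 * ∫ r in Ioc 0 T, F r := by
    rw [← MeasureTheory.integral_const_mul, ← integral_sub hηF (hF'.const_mul _)]
    refine setIntegral_congr_fun measurableSet_Ioc fun r hr => ?_
    rw [h1 r hr]
    ring
  rw [h2, h0] at key
  rw [setIntegral_congr_set (Ioo_ae_eq_Ioc (μ := volume) (a := 0) (b := T)),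
    setIntegral_congr_set (Ioo_ae_eq_Ioc (μ := volume) (a := 0) (b := T))]
  linarith

/-! ### The lemma -/

/-- The primitive `Φ(t) = ∫₀ᵗ φ` of a smooth function is smooth. [folklore] -/
theorem contDiff_primitive {φ : ℝ → ℝ} (hφ : ContDiff ℝ ∞ φ) (a : ℝ) :
    ContDiff ℝ ∞ fun t => ∫ x in a..t, φ x := by
  have hd : ∀ t, HasDerivAt (fun u => ∫ x in a..u, φ x) (φ t) t := fun t =>
    (hφ.continuous.integral_hasStrictDerivAt a t).hasDerivAt
  rw [contDiff_infty_iff_deriv]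
  refine ⟨fun t => (hd t).differentiableAt, ?_⟩
  have : deriv (fun u => ∫ x in a..u, φ x) = φ := funext fun t => (hd t).deriv
  rwa [this]

/-- **du Bois-Reymond lemma with initial datum, a.e. form.** Let `U, F : ℝ → ℝ` be integrable on
`(0, T)`, `c ∈ ℝ`, and assume that for every smooth compactly supported `η : ℝ → ℝ` with
`tsupport η ⊆ (-∞, T)`, `∫_{s ∈ (0,T)} (η'(s) U(s) + η(s) F(s)) + η(0) c = 0`. Then
`U(t) = c + ∫_{s ∈ (0,t]} F(s)` for almost every `t ∈ (0, T)` (Brezis 2011, Lemma 8.1 / proof of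
Thm. 8.2; Galdi 2000, Lemma 2.1; the form used in DiPerna–Lions 1989, proof of Thm. II.2, where
the mollified solution `θ_ε(·, x)` is only known to be integrable in time). Proof: the continuous
function `V(t) = c + ∫_{(0,t]} F` satisfies the same identity (`setIntegral_deriv_mul_primitive`),
hence `∫_{(0,T)} η' (U - V) = 0` for all admissible `η`; every smooth `φ` with compact support in
`(0, T)` equals `η'` on `(0, T)` for the admissible `η = B · (∫₀ φ - ∫ φ)` (`B` a bump `≡ 1` on
`[-1, T + 1]`), so `∫ φ (U - V) = 0` and Mathlib's fundamental lemma of the calculus of variations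
concludes. [cite: Brezis2011, Lemma 8.1] -/
theorem ae_eq_add_setIntegral_of_forall_test {T c : ℝ} {U F : ℝ → ℝ}
    (hU : IntegrableOn U (Ioo 0 T)) (hF : IntegrableOn F (Ioo 0 T))
    (h : ∀ η : ℝ → ℝ, ContDiff ℝ ∞ η → HasCompactSupport η → tsupport η ⊆ Iio T →
      (∫ s in Ioo 0 T, (deriv η s * U s + η s * F s)) + η 0 * c = 0) :
    ∀ᵐ t ∂(volume.restrict (Ioo 0 T)), U t = c + ∫ s in Ioc 0 t, F s := by
  rcases le_or_gt T 0 with hT0 | hT0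
  · rw [Ioo_eq_empty_of_le hT0, Measure.restrict_empty, ae_zero]
    exact Filter.eventually_bot
  -- the continuous solution `V` of the same identity, built on the extension `F'` of `F` by `0`
  set F' : ℝ → ℝ := (Ioo 0 T).indicator F with hF'
  have hF'i : Integrable F' volume := hF.integrable_indicator measurableSet_Ioo
  set V : ℝ → ℝ := fun t => c + ∫ s in (0 : ℝ)..t, F' s with hV
  have hVc : Continuous V :=
    continuous_const.add (intervalIntegral.continuous_primitive
      (fun a b => hF'i.intervalIntegrable) 0)
  have hVi : IntegrableOn V (Ioo 0 T) :=
    (hVc.integrableOn_Icc (a := 0) (b := T)).mono_set Ioo_subset_Icc_self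
  -- `V t = c + ∫_{(0,t]} F` on `(0, T)`
  have hVeq : ∀ t ∈ Ioo 0 T, V t = c + ∫ s in Ioc 0 t, F s := fun t ht => by
    have hset : Ioc 0 t ∩ Ioo 0 T = Ioc 0 t := by
      ext s
      simp only [mem_inter_iff, mem_Ioc, mem_Ioo]
      constructor
      · rintro ⟨⟨h1, h2⟩, -⟩
        exact ⟨h1, h2⟩
      · rintro ⟨h1, h2⟩
        exact ⟨⟨h1, h2⟩, h1, lt_of_le_of_lt h2 ht.2⟩
    show c + ∫ s in (0 : ℝ)..t, F' s = _
    rw [intervalIntegral.integral_of_le ht.1.le, hF', setIntegral_indicator measurableSet_Ioo,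
      hset]
  have hprim : ∀ s ∈ Ioo 0 T, ∫ r in Ioc 0 s, F' r = ∫ r in (0 : ℝ)..s, F' r := fun s hs => by
    rw [intervalIntegral.integral_of_le hs.1.le]
  -- `V` satisfies the identity
  have hVid : ∀ η : ℝ → ℝ, ContDiff ℝ ∞ η → HasCompactSupport η → tsupport η ⊆ Iio T →
      (∫ s in Ioo 0 T, (deriv η s * V s + η s * F s)) + η 0 * c = 0 := by
    intro η hη hsupp hηT
    have hη1 : ContDiff ℝ 1 η := hη.of_le (by exact_mod_cast le_top)
    have hdc : Continuous (deriv η) := hη.continuous_deriv (by exact_mod_cast le_top)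
    have hdsupp : HasCompactSupport (deriv η) := hsupp.deriv
    have hibp := setIntegral_deriv_mul_primitive (hF'i.integrableOn (s := Ioo 0 T)) hη1 hsupp hηT
    -- `∫ η' V = c ∫ η' + ∫ η' ∫ F' = -c η 0 - ∫ η F`
    have hint1 : IntegrableOn (fun s => deriv η s * c) (Ioo 0 T) :=
      (hdc.mul continuous_const).integrableOn_Icc.mono_set Ioo_subset_Icc_self
    have hint2 : IntegrableOn (fun s => deriv η s * ∫ r in (0 : ℝ)..s, F' r) (Ioo 0 T) :=
      (hdc.mul (intervalIntegral.continuous_primitive (fun a b => hF'i.intervalIntegrable) 0)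
        ).integrableOn_Icc.mono_set Ioo_subset_Icc_self
    have hint3 : IntegrableOn (fun s => η s * F s) (Ioo 0 T) :=
      integrableOn_continuous_mul_of_hasCompactSupport hF hη.continuous hsupp
    have hsplit : ∫ s in Ioo 0 T, (deriv η s * V s + η s * F s) =
        (∫ s in Ioo 0 T, deriv η s * c) + (∫ s in Ioo 0 T, deriv η s * ∫ r in (0 : ℝ)..s, F' r) +
          ∫ s in Ioo 0 T, η s * F s := by
      have e1 : ∫ s in Ioo 0 T, (deriv η s * V s + η s * F s) =
          ∫ s in Ioo 0 T, ((deriv η s * c + deriv η s * ∫ r in (0 : ℝ)..s, F' r) + η s * F s) :=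
        setIntegral_congr_fun measurableSet_Ioo fun s _ => by
          show deriv η s * (c + ∫ r in (0 : ℝ)..s, F' r) + η s * F s = _
          ring
      rw [e1, integral_add (f := fun s => deriv η s * c + deriv η s * ∫ r in (0 : ℝ)..s, F' r)
        (hint1.add hint2) hint3, integral_add hint1 hint2]
    have hA : ∫ s in Ioo 0 T, deriv η s * c = -η 0 * c := by
      rw [MeasureTheory.integral_mul_const, ← setIntegral_congr_set (Ioo_ae_eq_Ioc (μ := volume)).symm,
        setIntegral_Ioc_deriv_eq_neg hη1 hsupp hηT hT0.le]
    have hB : ∫ s in Ioo 0 T, deriv η s * ∫ r in (0 : ℝ)..s, F' r = -∫ s in Ioo 0 T, η s * F s := by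
      have e1 : ∫ s in Ioo 0 T, deriv η s * ∫ r in (0 : ℝ)..s, F' r =
          ∫ s in Ioo 0 T, deriv η s * ∫ r in Ioc 0 s, F' r :=
        setIntegral_congr_fun measurableSet_Ioo fun s hs => by rw [hprim s hs]
      have e2 : ∫ s in Ioo 0 T, η s * F' s = ∫ s in Ioo 0 T, η s * F s :=
        setIntegral_congr_fun measurableSet_Ioo fun s hs => by
          simp only [hF', indicator_of_mem hs]
      rw [e1, hibp, e2]
    rw [hsplit, hA, hB]
    ring
  -- `W = U - V` is orthogonal to every `η'`
  have hW : ∀ η : ℝ → ℝ, ContDiff ℝ ∞ η → HasCompactSupport η → tsupport η ⊆ Iio T →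
      ∫ s in Ioo 0 T, deriv η s * (U s - V s) = 0 := by
    intro η hη hsupp hηT
    have hdc : Continuous (deriv η) := hη.continuous_deriv (by exact_mod_cast le_top)
    have hdsupp : HasCompactSupport (deriv η) := hsupp.deriv
    have i1 : IntegrableOn (fun s => deriv η s * U s) (Ioo 0 T) :=
      integrableOn_continuous_mul_of_hasCompactSupport hU hdc hdsupp
    have i2 : IntegrableOn (fun s => deriv η s * V s) (Ioo 0 T) :=
      integrableOn_continuous_mul_of_hasCompactSupport hVi hdc hdsupp
    have i3 : IntegrableOn (fun s => η s * F s) (Ioo 0 T) :=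
      integrableOn_continuous_mul_of_hasCompactSupport hF hη.continuous hsupp
    have e1 := h η hη hsupp hηT
    have e2 := hVid η hη hsupp hηT
    rw [integral_add i1 i3] at e1
    rw [integral_add i2 i3] at e2
    have : ∫ s in Ioo 0 T, deriv η s * (U s - V s) =
        (∫ s in Ioo 0 T, deriv η s * U s) - ∫ s in Ioo 0 T, deriv η s * V s := by
      rw [← integral_sub i1 i2]
      refine integral_congr_ae (Eventually.of_forall fun s => ?_)
      ring
    rw [this]
    linarith
  -- a bump `B ≡ 1` on `[-1, T + 1]`
  let B : ContDiffBump (T / 2 : ℝ) := ⟨T / 2 + 1, T / 2 + 2, by linarith, by linarith⟩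
  have hBr : B.rIn = T / 2 + 1 := rfl
  have hB1 : ∀ s ∈ Icc (-1 : ℝ) (T + 1), (B : ℝ → ℝ) s = 1 := fun s hs =>
    B.one_of_mem_closedBall (by
      rw [Metric.mem_closedBall, Real.dist_eq, hBr, abs_le]; constructor <;> linarith [hs.1, hs.2])
  have hB1' : ∀ s ∈ Ioo (-1 : ℝ) (T + 1), (B : ℝ → ℝ) =ᶠ[𝓝 s] fun _ => 1 := fun s hs => by
    filter_upwards [Ioo_mem_nhds hs.1 hs.2] with x hx using hB1 x (Ioo_subset_Icc_self hx)
  -- every smooth `φ` supported in `(0, T)` is orthogonal to `W`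
  have hφW : ∀ φ : ℝ → ℝ, ContDiff ℝ ∞ φ → HasCompactSupport φ → tsupport φ ⊆ Ioo 0 T →
      ∫ s, φ s • (Ioo 0 T).indicator (fun s => U s - V s) s = 0 := by
    intro φ hφ hφsupp hφT
    obtain ⟨T', hT'T, hT'⟩ := exists_lt_forall_eq_zero_of_tsupport_subset_Iio hφsupp
      (hφT.trans Ioo_subset_Iio_self)
    have hφ0 : ∀ s, s ≤ 0 → φ s = 0 := fun s hs =>
      image_eq_zero_of_notMem_tsupport fun h' => (lt_irrefl (0 : ℝ)) (lt_of_lt_of_le (hφT h').1 hs)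
    -- the primitive `Φ(t) = ∫₀ᵗ φ - ∫₀^{T'} φ`
    set I : ℝ := ∫ x in (0 : ℝ)..T', φ x with hI
    set Φ : ℝ → ℝ := fun t => (∫ x in (0 : ℝ)..t, φ x) - I with hΦ
    have hΦs : ContDiff ℝ ∞ Φ := (contDiff_primitive hφ 0).sub contDiff_const
    have hΦd : ∀ t, HasDerivAt Φ (φ t) t := fun t =>
      ((hφ.continuous.integral_hasStrictDerivAt 0 t).hasDerivAt).sub_const I
    have hΦT : ∀ t, T' ≤ t → Φ t = 0 := fun t ht => by
      simp only [hΦ, hI]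
      rw [sub_eq_zero, ← intervalIntegral.integral_add_adjacent_intervals
        (hφ.continuous.intervalIntegrable 0 T') (hφ.continuous.intervalIntegrable T' t),
        add_eq_left]
      exact intervalIntegral.integral_zero_ae (Eventually.of_forall fun x hx => by
        rw [uIoc_of_le ht] at hx
        exact hT' x hx.1.le)
    set η : ℝ → ℝ := fun t => B t * Φ t with hη
    have hηs : ContDiff ℝ ∞ η := B.contDiff.mul hΦs
    have hηsupp : HasCompactSupport η := B.hasCompactSupport.mul_right
    have hηT : tsupport η ⊆ Iio T := by
      refine (closure_minimal (fun s hs => ?_) isClosed_Iic).trans (Iic_subset_Iio.2 hT'T)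
      by_contra hs'
      exact hs (by simp only [hη, hΦT s (not_le.1 hs').le, mul_zero])
    have hηd : ∀ s ∈ Ioo 0 T, deriv η s = φ s := fun s hs => by
      have h1 : η =ᶠ[𝓝 s] Φ := by
        filter_upwards [hB1' s ⟨by linarith [hs.1], by linarith [hs.2]⟩] with x hx
        simp only [hη, hx, one_mul]
      rw [h1.deriv_eq]
      exact (hΦd s).deriv
    have key := hW η hηs hηsupp hηT
    have hind : (fun s => φ s • (Ioo 0 T).indicator (fun s => U s - V s) s) =
        (Ioo 0 T).indicator (fun s => φ s • (U s - V s)) := by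
      funext s
      by_cases hs : s ∈ Ioo 0 T
      · simp only [indicator_of_mem hs]
      · simp only [indicator_of_notMem hs, smul_zero]
    rw [hind, MeasureTheory.integral_indicator measurableSet_Ioo]
    refine Eq.trans (setIntegral_congr_fun measurableSet_Ioo fun s hs => ?_) key
    rw [hηd s hs, smul_eq_mul]
  -- the fundamental lemma of the calculus of variations on the open set `(0, T)`
  have hloc : LocallyIntegrableOn ((Ioo 0 T).indicator fun s => U s - V s) (Ioo 0 T) volume :=
    (((hU.sub hVi).integrable_indicator measurableSet_Ioo).integrableOn).locallyIntegrableOn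
  have hae := (isOpen_Ioo (a := (0 : ℝ)) (b := T)).ae_eq_zero_of_integral_contDiff_smul_eq_zero
    hloc hφW
  rw [ae_restrict_iff' measurableSet_Ioo]
  filter_upwards [hae] with t ht htmem
  have := ht htmem
  rw [indicator_of_mem htmem, sub_eq_zero] at this
  rw [this, hVeq t htmem]

/-! ### The product of two primitives of `L¹` functions -/

/-- **Product formula for primitives** (integration by parts for absolutely continuous
functions, in integral form): if `F(t) = α + ∫_{(0,t]} φ` and `G(t) = β + ∫_{(0,t]} γ` on
`(0, T]` with `φ, γ ∈ L¹(0,T)`, then `s ↦ φ(s)G(s) + F(s)γ(s)` is integrable on `(0,t]` and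
`F(t)G(t) = αβ + ∫_{(0,t]} (φ G + F γ)` for every `t ∈ (0, T]` (Fubini on the triangle,
`setIntegral_mul_setIntegral_add_symm`; the primitives are continuous, hence bounded, on `[0,t]`). [folklore] -/
theorem mul_eq_add_setIntegral_of_eq_add_setIntegral {T : ℝ} {F G φ γ : ℝ → ℝ} {α β : ℝ}
    (hφ : IntegrableOn φ (Ioo 0 T)) (hγ : IntegrableOn γ (Ioo 0 T))
    (hF : ∀ t ∈ Ioc 0 T, F t = α + ∫ s in Ioc 0 t, φ s)
    (hG : ∀ t ∈ Ioc 0 T, G t = β + ∫ s in Ioc 0 t, γ s) {t : ℝ} (ht : t ∈ Ioc 0 T) :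
    IntegrableOn (fun s => φ s * G s + F s * γ s) (Ioc 0 t) ∧
      F t * G t = α * β + ∫ s in Ioc 0 t, (φ s * G s + F s * γ s) := by
  have hsub : Ioc 0 t ⊆ Ioc 0 T := Ioc_subset_Ioc_right ht.2
  -- integrability on `(0, t]`
  have hφT : IntegrableOn φ (Ioc 0 T) := (integrableOn_Ioc_iff_integrableOn_Ioo (f := φ)).2 hφ
  have hγT : IntegrableOn γ (Ioc 0 T) := (integrableOn_Ioc_iff_integrableOn_Ioo (f := γ)).2 hγ
  have hφt : IntegrableOn φ (Ioc 0 t) := hφT.mono_set hsub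
  have hγt : IntegrableOn γ (Ioc 0 t) := hγT.mono_set hsub
  -- the primitives are continuous, hence bounded, on `[0, t]`
  set Φ : ℝ → ℝ := fun s => ∫ r in Ioc 0 s, φ r with hΦ
  set Γ : ℝ → ℝ := fun s => ∫ r in Ioc 0 s, γ r with hΓ
  have hΦc : ContinuousOn Φ (Icc 0 t) :=
    intervalIntegral.continuousOn_primitive ((integrableOn_Icc_iff_integrableOn_Ioc (f := φ)).2 hφt)
  have hΓc : ContinuousOn Γ (Icc 0 t) :=
    intervalIntegral.continuousOn_primitive ((integrableOn_Icc_iff_integrableOn_Ioc (f := γ)).2 hγt)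
  obtain ⟨CΦ, hCΦ⟩ := isCompact_Icc.exists_bound_of_continuousOn hΦc
  obtain ⟨CΓ, hCΓ⟩ := isCompact_Icc.exists_bound_of_continuousOn hΓc
  have hΦm : AEStronglyMeasurable Φ (volume.restrict (Ioc 0 t)) :=
    (hΦc.mono Ioc_subset_Icc_self).aestronglyMeasurable measurableSet_Ioc
  have hΓm : AEStronglyMeasurable Γ (volume.restrict (Ioc 0 t)) :=
    (hΓc.mono Ioc_subset_Icc_self).aestronglyMeasurable measurableSet_Ioc
  have hΦb : ∀ᵐ s ∂(volume.restrict (Ioc 0 t)), ‖Φ s‖ ≤ CΦ :=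
    (ae_restrict_mem measurableSet_Ioc).mono fun s hs => hCΦ s (Ioc_subset_Icc_self hs)
  have hΓb : ∀ᵐ s ∂(volume.restrict (Ioc 0 t)), ‖Γ s‖ ≤ CΓ :=
    (ae_restrict_mem measurableSet_Ioc).mono fun s hs => hCΓ s (Ioc_subset_Icc_self hs)
  have i1 : IntegrableOn (fun s => φ s * Γ s) (Ioc 0 t) := by
    have h := hφt.bdd_mul hΓm hΓb
    exact h.congr (ae_of_all _ fun s => mul_comm _ _)
  have i2 : IntegrableOn (fun s => γ s * Φ s) (Ioc 0 t) := by
    have h := hγt.bdd_mul hΦm hΦb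
    exact h.congr (ae_of_all _ fun s => mul_comm _ _)
  -- on `(0, t]` the given functions are the primitives
  have hG' : ∀ᵐ s ∂(volume.restrict (Ioc 0 t)), φ s * G s = β * φ s + φ s * Γ s :=
    (ae_restrict_mem measurableSet_Ioc).mono fun s hs => by rw [hG s (hsub hs)]; ring
  have hF' : ∀ᵐ s ∂(volume.restrict (Ioc 0 t)), F s * γ s = α * γ s + γ s * Φ s :=
    (ae_restrict_mem measurableSet_Ioc).mono fun s hs => by rw [hF s (hsub hs)]; ring
  have j1 : IntegrableOn (fun s => φ s * G s) (Ioc 0 t) :=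
    ((hφt.const_mul β).add i1).congr (hG'.mono fun s hs => hs.symm)
  have j2 : IntegrableOn (fun s => F s * γ s) (Ioc 0 t) :=
    ((hγt.const_mul α).add i2).congr (hF'.mono fun s hs => hs.symm)
  refine ⟨j1.add j2, ?_⟩
  rw [integral_add j1 j2, integral_congr_ae hG', integral_congr_ae hF',
    integral_add (hφt.const_mul β) i1, integral_add (hγt.const_mul α) i2, MeasureTheory.integral_const_mul,
    MeasureTheory.integral_const_mul, hF t ht, hG t ht]
  have key := setIntegral_mul_setIntegral_add_symm hφt hγt
  calc (α + Φ t) * (β + Γ t) = α * β + (β * Φ t + α * Γ t + Φ t * Γ t) := by ring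
    _ = α * β + (β * Φ t + (∫ s in Ioc 0 t, φ s * Γ s) + (α * Γ t + ∫ s in Ioc 0 t, γ s * Φ s)) := by
        rw [hΦ, hΓ]
        dsimp only
        rw [← key]
        ring

end Literature.Analysis.FunctionSpaces
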